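import Summits.NavierStokesRegularity.NavierStokesRegularity.Theses.QuantisedSymmetry
import Summits.NavierStokesRegularity.NavierStokesRegularity.Theses.Blowup
import Summits.NavierStokesRegularity.NavierStokesRegularity.Theses.DssFarFieldSlaving
import Summits.NavierStokesRegularity.NavierStokesRegularity.Theorems.QuantisedSymmetryPolyhedralTruncationBridge
import Summits.NavierStokesRegularity.NavierStokesRegularity.Theorems.QuantisedSymmetryLiouvilleKillsProfile
import Summits.NavierStokesRegularity.NavierStokesRegularity.Theorems.QuantisedSymmetryPolyhedralDssProfileExistsOfCell
import Summits.NavierStokesRegularity.NavierStokesRegularity.Theorems.QuantisedSymmetryPolyhedralDssProfileExistsCellOfProfile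
import Summits.NavierStokesRegularity.NavierStokesRegularity.Theorems.QuantisedSymmetryPolyhedralDssProfileExistsDominatesBlowupProfile
import Summits.NavierStokesRegularity.NavierStokesRegularity.Theorems.DssFarFieldSlavingDssTruncationBridge
import HarnessLib

/-!
# Strategist sketch s21 (family `-s`, second independent census) for the crux
`QuantisedSymmetry.PolyhedralDssProfileExists` (stmt-NavierStokesRegularity-1404)

Companion to `STRATEGY-CENSUS-s21.md`.  Nothing here is a new line or a new route: the file
TYPE-CHECKS the objects the census talks about, so that every "no leverage" verdict is about a
precise statement.

* §0 `crux_decides` — the crux decides the summit on the negative side **by name**, using only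
  PROVED items of the route (`PolyhedralTruncationBridge`, `ClayUniqueness`): the crux is `≥ ¬S`.
* §1 weaker intermediates `W1` (= stmt-0155, sector-free Type-I DSS profile), `W2` (= X5a,
  finite-time blow-up of a Leray–Hopf classical solution from a rapidly decaying datum), both
  implied by the crux AND both deciding the summit by name (so neither is "short of the summit");
  `W3` (= ¬ kill switch) and `W6` (bounded polyhedral DSS orbit WITHOUT spatial Type-I decay),
  both implied by the crux and NOT summit-bearing (no `closes` can consume them).
* §2 the Newton–Kantorovich / computer-assisted split `NKCellTheorem → NKCertificateExists → crux`
  with its assembly PROVED (modus ponens through the landed reduction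
  `stub_profileOfPolyhedralCell`); the census explains why the certificate half is the whole crux.
* §3 the strengthening `NondegenerateCellExists` (S⁺) and `S⁺ → crux`.
* §4 the negation target is the route's own kill switch (`PolyhedralTypeILiouville → ¬ crux`, landed).

`lean check`: rc 0, no `sorry`.
-/

noncomputable section

namespace Summit.NavierStokesRegularity.NavierStokesRegularity.Cruxes.PolyhedralDssProfileExists.StrategistS21

set_option linter.dupNamespace false

open MeasureTheory Set Function
open Literature.Analysis.FluidPDE
open _root_.Summit.NavierStokesRegularity.NavierStokesRegularity

/-- The crux, by name. -/
abbrev Crux : Prop := Theses.QuantisedSymmetry.PolyhedralDssProfileExists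

/-- The summit statement, by name. -/
abbrev S : Prop := _root_.NavierStokesRegularity

/-! ## §0 The crux decides the summit (negative side) — a tree theorem -/

/-- `X⁻ → ¬ NavierStokesRegularity` with the two other binders of `QuantisedSymmetry.closes`
discharged by their landed proofs. Consequence: any replacement crux that still feeds a deciding
theorem of this (negative) route must itself imply `¬S`. -/
theorem crux_decides : Crux → ¬ S := fun hX =>
  Theses.QuantisedSymmetry.closes hX Theorems.quantisedSymmetry_polyhedralTruncationBridge_proof
    Theses.QuantisedSymmetry.ClayUniqueness_holds

/-! ## §1 Weaker intermediates -/

/-- W1 = stmt-0155 (sector-free Type-I (rotated-)DSS ancient mild profile exists), as it is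
declared in the OPEN route `DssFarFieldSlaving`. -/
abbrev W1 : Prop := Theses.DssFarFieldSlaving.BlowupTypeIDssProfile

/-- The crux dominates W1 (landed, lead c15: `stub_dominatesBlowupProfile`; the two route copies
of 0155 have the same body). -/
theorem crux_imp_w1 : Crux → W1 := fun hX => by
  have h := Theorems.PolyhedralDssProfileExists.PolyhedralCell.stub_dominatesBlowupProfile hX
  dsimp only [W1, Theses.DssFarFieldSlaving.BlowupTypeIDssProfile]
  dsimp only [Theses.Blowup.BlowupTypeIDssProfile] at h
  exact h

/-- W1 decides the summit BY NAME (route `DssFarFieldSlaving`, bridge `DssTruncationBridge`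
PROVED, stmt-14477): W1 is not short of the summit. -/
theorem w1_decides : W1 → ¬ S := fun h =>
  Theses.DssFarFieldSlaving.closes Theorems.dssTruncationBridge_proof h

/-- W2 = X5a (finite-time blow-up of a Leray–Hopf classical solution from a rapidly decaying
datum), as declared in route `Blowup`. -/
abbrev W2 : Prop := Theses.Blowup.BlowupExists

/-- The crux implies W2 (the PROVED per-profile truncation bridge, stmt-11331). -/
theorem crux_imp_w2 : Crux → W2 := by
  rintro ⟨G, hfin, hdet, hirr, c, hc, u, hanc, hmeas, hdss, hdec, heqv, hnt⟩
  exact Theorems.quantisedSymmetry_polyhedralTruncationBridge_proof G hfin hdet hirr c hc u hanc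
    hmeas hdss hdec heqv hnt

/-- W2 decides the summit BY NAME (route `Blowup`'s deciding theorem with its second binder
proved): W2 is not short of the summit either. -/
theorem w2_decides : W2 → ¬ S := fun h =>
  Theses.Blowup.closes h Theses.Blowup.BlowupClayUniqueness_holds

/-- W3 = negation of the route's kill switch (a bounded polyhedrally-equivariant ancient mild
solution with Type-I decay which is not a.e. trivial exists — no self-similarity). -/
abbrev W3 : Prop := ¬ Theses.QuantisedSymmetry.PolyhedralTypeILiouville

/-- The crux implies W3 (landed glue `LiouvilleKillsProfile`, stmt-1408). W3 is NOT
summit-bearing: without self-similarity no truncation bridge is known (census §1). -/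
theorem crux_imp_w3 : Crux → W3 := fun hX hL => by
  have h := Theorems.quantisedSymmetry_liouvilleKillsProfile_proof
  dsimp only [Theses.QuantisedSymmetry.LiouvilleKillsProfile] at h
  exact h hL hX

/-- W6: a bounded-in-time (Type-I TIME decay only) polyhedral `c`-DSS ancient mild orbit which is
not a.e. trivial — the crux with the SPATIAL Type-I decay `C₀/(‖x‖+√-t)` weakened to `M/√-t`.
Not summit-bearing: every truncation bridge in the tree consumes `HasTypeIDecay`. -/
def W6 : Prop :=
  ∃ G : Subgroup (EuclideanSpace ℝ (Fin 3) ≃ₗᵢ[ℝ] EuclideanSpace ℝ (Fin 3)), Finite G ∧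
    (∀ g ∈ G, LinearMap.det (g.toLinearEquiv : EuclideanSpace ℝ (Fin 3) →ₗ[ℝ] EuclideanSpace ℝ (Fin 3)) = 1) ∧
    (∀ V : Submodule ℝ (EuclideanSpace ℝ (Fin 3)), (∀ g ∈ G, ∀ v ∈ V, g v ∈ V) → V = ⊥ ∨ V = ⊤) ∧
    ∃ c : ℝ, 1 < c ∧ ∃ u : ℝ → EuclideanSpace ℝ (Fin 3) → EuclideanSpace ℝ (Fin 3),
      IsAncientMildSolution 1 u ∧ (∀ t < 0, AEStronglyMeasurable (u t) volume) ∧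
      IsDiscretelySelfSimilar c u ∧ (∃ M : ℝ, HasTypeITimeDecay M u) ∧
      (∀ g ∈ G, ∀ t x, u t (g x) = g (u t x)) ∧ ¬ (∀ t < 0, u t =ᵐ[volume] 0)

/-- The crux implies W6 (drop `‖x‖` from the denominator). -/
theorem crux_imp_w6 : Crux → W6 := by
  rintro ⟨G, hfin, hdet, hirr, c, hc, u, hanc, hmeas, hdss, ⟨C₀, hdec⟩, heqv, hnt⟩
  have hC₀ : 0 ≤ C₀ := by
    have h1 := hdec (-1) (by norm_num) 0
    have : (0 : ℝ) ≤ C₀ / (‖(0 : EuclideanSpace ℝ (Fin 3))‖ + Real.sqrt (-(-1 : ℝ))) :=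
      (norm_nonneg _).trans h1
    simpa using this
  exact ⟨G, hfin, hdet, hirr, c, hc, u, hanc, hmeas, hdss, ⟨C₀, hdec.hasTypeITimeDecay hC₀⟩, heqv, hnt⟩

/-! ## §2 The Newton–Kantorovich / computer-assisted split (typed; assembly proved) -/

/-- Polyhedral group: finite, proper rotations, irreducible on `ℝ³` (T/O/I up to conjugacy). -/
def IsPolyhedral (G : Subgroup (EuclideanSpace ℝ (Fin 3) ≃ₗᵢ[ℝ] EuclideanSpace ℝ (Fin 3))) : Prop :=
  Finite G ∧
    (∀ g ∈ G, LinearMap.det (g.toLinearEquiv : EuclideanSpace ℝ (Fin 3) →ₗ[ℝ] EuclideanSpace ℝ (Fin 3)) = 1) ∧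
    (∀ V : Submodule ℝ (EuclideanSpace ℝ (Fin 3)), (∀ g ∈ G, ∀ v ∈ V, g v ∈ V) → V = ⊥ ∨ V = ⊤)

/-- An `ε`-APPROXIMATE `G`-cell on the model period `[-1,-c⁻²]` with sup bound `M`: all clauses of
the line's `PolyhedralCellExists` (joint continuity, boundedness, weak solenoidality, Oseen-mildness,
slice-wise equivariance, `L⁴` datum) except that the closing identity under the zoom holds only up
to `ε` uniformly. `ε = 0` is an exact cell. -/
def IsApproxCell (G : Subgroup (EuclideanSpace ℝ (Fin 3) ≃ₗᵢ[ℝ] EuclideanSpace ℝ (Fin 3)))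
    (c ε M : ℝ) (v : ℝ → EuclideanSpace ℝ (Fin 3) → EuclideanSpace ℝ (Fin 3)) : Prop :=
  ContinuousOn (Function.uncurry v) (Set.Icc (-1 : ℝ) (-(c ^ 2)⁻¹) ×ˢ Set.univ) ∧
    (∀ t ∈ Set.Icc (-1 : ℝ) (-(c ^ 2)⁻¹), ∀ x, ‖v t x‖ ≤ M) ∧
    (∀ t ∈ Set.Icc (-1 : ℝ) (-(c ^ 2)⁻¹), IsWeaklyDivFree (v t)) ∧
    (∀ s t : ℝ, -1 ≤ s → s < t → t ≤ -(c ^ 2)⁻¹ → ∀ x,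
      v t x = heatFlow (v s) (t - s) x - oseenDuhamel 1 s v v t x) ∧
    (∀ x, ‖v (-(c ^ 2)⁻¹) x - c • v (-1) (c • x)‖ ≤ ε) ∧
    (∀ g ∈ G, ∀ t ∈ Set.Icc (-1 : ℝ) (-(c ^ 2)⁻¹), ∀ x, v t (g x) = g (v t x)) ∧
    MemLp (v (-1)) 4 volume

/-- A solution `w` of the cell equation LINEARISED at `v` (Oseen-mild in both slots) on the model
period. -/
def IsLinearisedCell (c : ℝ) (v w : ℝ → EuclideanSpace ℝ (Fin 3) → EuclideanSpace ℝ (Fin 3)) : Prop :=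
  ContinuousOn (Function.uncurry w) (Set.Icc (-1 : ℝ) (-(c ^ 2)⁻¹) ×ˢ Set.univ) ∧
    (∃ B : ℝ, ∀ t ∈ Set.Icc (-1 : ℝ) (-(c ^ 2)⁻¹), ∀ x, ‖w t x‖ ≤ B) ∧
    (∀ t ∈ Set.Icc (-1 : ℝ) (-(c ^ 2)⁻¹), IsWeaklyDivFree (w t)) ∧
    (∀ s t : ℝ, -1 ≤ s → s < t → t ≤ -(c ^ 2)⁻¹ → ∀ x,
      w t x = heatFlow (w s) (t - s) x - oseenDuhamel 1 s v w t x - oseenDuhamel 1 s w v t x)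

/-- `K`-bounded solvability of the LINEARISED CLOSING equation `w₀ - 𝒮_c⁻¹ (DΦ(v) w₀) = f` on
bounded continuous weakly solenoidal `G`-equivariant right-hand sides (`(𝒮_c⁻¹ w)(x) = c⁻¹ w(c⁻¹x)`
is the zoom-out, an `L^∞`-contraction by `c⁻¹`; `DΦ(v)` the linearised period flow): the
nondegeneracy hypothesis of Newton–Kantorovich, `‖(I - D𝓡_G(v))⁻¹‖ ≤ K`. -/
def LinearisedClosingInvertible (G : Subgroup (EuclideanSpace ℝ (Fin 3) ≃ₗᵢ[ℝ] EuclideanSpace ℝ (Fin 3)))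
    (c K : ℝ) (v : ℝ → EuclideanSpace ℝ (Fin 3) → EuclideanSpace ℝ (Fin 3)) : Prop :=
  ∀ (f : EuclideanSpace ℝ (Fin 3) → EuclideanSpace ℝ (Fin 3)) (B : ℝ), Continuous f → (∀ x, ‖f x‖ ≤ B) →
    IsWeaklyDivFree f → (∀ g ∈ G, ∀ x, f (g x) = g (f x)) →
    ∃ w : ℝ → EuclideanSpace ℝ (Fin 3) → EuclideanSpace ℝ (Fin 3), IsLinearisedCell c v w ∧
      (∀ x, w (-1) x - c⁻¹ • w (-(c ^ 2)⁻¹) (c⁻¹ • x) = f x) ∧ (∀ x, ‖w (-1) x‖ ≤ K * B)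

/-- **Sub₁ (NK cell theorem; a genuine, provable-in-principle a-posteriori existence theorem).**
There is an explicit threshold `θ(c, K, M) > 0` such that every `ε`-approximate polyhedral cell with
`K`-invertible linearised closing operator, `ε ≤ θ(c,K,M)` and a datum exceeding `2Kε` somewhere
has an EXACT nontrivial polyhedral cell (same `G`, same `c`) nearby. Format of Reiterer–Trubowitz
(Choptuik) and of every radii-polynomial proof; here `D𝓡_G = (c⁻¹-contraction) + (compact)` on
bounded uniformly continuous fields makes `I - D𝓡_G` Fredholm of index 0, so `K` is meaningful. -/
def NKCellTheorem : Prop :=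
  ∃ θ : ℝ → ℝ → ℝ → ℝ, (∀ c K M : ℝ, 1 < c → 0 < K → 0 ≤ M → 0 < θ c K M) ∧
    ∀ (G : Subgroup (EuclideanSpace ℝ (Fin 3) ≃ₗᵢ[ℝ] EuclideanSpace ℝ (Fin 3))) (c ε K M : ℝ)
      (v : ℝ → EuclideanSpace ℝ (Fin 3) → EuclideanSpace ℝ (Fin 3)),
      IsPolyhedral G → 1 < c → 0 < K → 0 ≤ M → 0 ≤ ε → IsApproxCell G c ε M v →
      LinearisedClosingInvertible G c K v → ε ≤ θ c K M → (∃ x, 2 * K * ε < ‖v (-1) x‖) →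
      ∃ (M' : ℝ) (v' : ℝ → EuclideanSpace ℝ (Fin 3) → EuclideanSpace ℝ (Fin 3)),
        IsApproxCell G c 0 M' v' ∧ ¬ (v' (-1) =ᵐ[volume] 0)

/-- **Sub₂ (the certificate).** For every positive threshold there is a polyhedral approximate cell
beating it, with an invertibility bound and a datum above the noise floor — what a verified
harmonic-balance / Newton–Krylov computation in the `G`-invariant sector would deliver. Truth
content: an exact NONDEGENERATE polyhedral cell exists (then Newton refinement beats every `θ`). -/
def NKCertificateExists : Prop :=
  ∀ θ : ℝ → ℝ → ℝ → ℝ, (∀ c K M : ℝ, 1 < c → 0 < K → 0 ≤ M → 0 < θ c K M) →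
    ∃ (G : Subgroup (EuclideanSpace ℝ (Fin 3) ≃ₗᵢ[ℝ] EuclideanSpace ℝ (Fin 3))) (c ε K M : ℝ)
      (v : ℝ → EuclideanSpace ℝ (Fin 3) → EuclideanSpace ℝ (Fin 3)),
      IsPolyhedral G ∧ 1 < c ∧ 0 < K ∧ 0 ≤ M ∧ 0 ≤ ε ∧ IsApproxCell G c ε M v ∧
      LinearisedClosingInvertible G c K v ∧ ε ≤ θ c K M ∧ (∃ x, 2 * K * ε < ‖v (-1) x‖)

/-- An exact (`ε = 0`) approximate cell is a cell in the sense of the line's ∃-stub. -/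
theorem cell_of_approxCell_zero
    {G : Subgroup (EuclideanSpace ℝ (Fin 3) ≃ₗᵢ[ℝ] EuclideanSpace ℝ (Fin 3))} {c M : ℝ}
    {v : ℝ → EuclideanSpace ℝ (Fin 3) → EuclideanSpace ℝ (Fin 3)} (h : IsApproxCell G c 0 M v) :
    (ContinuousOn (Function.uncurry v) (Set.Icc (-1 : ℝ) (-(c ^ 2)⁻¹) ×ˢ Set.univ) ∧
        (∃ M : ℝ, ∀ t ∈ Set.Icc (-1 : ℝ) (-(c ^ 2)⁻¹), ∀ x, ‖v t x‖ ≤ M) ∧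
        (∀ t ∈ Set.Icc (-1 : ℝ) (-(c ^ 2)⁻¹), IsWeaklyDivFree (v t)) ∧
        (∀ s t : ℝ, -1 ≤ s → s < t → t ≤ -(c ^ 2)⁻¹ → ∀ x,
          v t x = heatFlow (v s) (t - s) x - oseenDuhamel 1 s v v t x) ∧
        (∀ x, v (-(c ^ 2)⁻¹) x = c • v (-1) (c • x)) ∧
        (∀ g ∈ G, ∀ t ∈ Set.Icc (-1 : ℝ) (-(c ^ 2)⁻¹), ∀ x, v t (g x) = g (v t x))) ∧
      MemLp (v (-1)) 4 volume := by
  obtain ⟨hcont, hbd, hdiv, hmild, hclose, heqv, hL4⟩ := h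
  refine ⟨⟨hcont, ⟨M, hbd⟩, hdiv, hmild, fun x => ?_, heqv⟩, hL4⟩
  have := hclose x
  have h0 : ‖v (-(c ^ 2)⁻¹) x - c • v (-1) (c • x)‖ = 0 :=
    le_antisymm this (norm_nonneg _)
  exact sub_eq_zero.mp (norm_eq_zero.mp h0)

/-- **Assembly of the split, PROVED:** `Sub₁ → Sub₂ → crux` — modus ponens, then the landed
reduction `stub_profileOfPolyhedralCell` (p152884). The join is trivial; the census records why the
certificate half `NKCertificateExists` is the whole crux (no candidate exists to certify). -/
theorem crux_of_nk : NKCellTheorem → NKCertificateExists → Crux := by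
  rintro ⟨θ, hθ, hNK⟩ hcert
  obtain ⟨G, c, ε, K, M, v, hG, hc, hK, hM, hε, happ, hinv, hsmall, hbig⟩ := hcert θ hθ
  obtain ⟨M', v', hcell, hnt⟩ := hNK G c ε K M v hG hc hK hM hε happ hinv hsmall hbig
  obtain ⟨hcell', hL4⟩ := cell_of_approxCell_zero hcell
  exact Theorems.PolyhedralDssProfileExists.PolyhedralCell.stub_profileOfPolyhedralCell
    ⟨G, hG.1, hG.2.1, hG.2.2, c, hc, v', hcell', hL4, hnt⟩

/-! ## §3 Strengthening S⁺: a NONDEGENERATE polyhedral cell -/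

/-- S⁺: an exact nontrivial polyhedral cell whose linearised closing operator is boundedly
invertible (isolated, transversal fixed point of `𝓡_G`). Buys openness in parameters (`c`, the
bilinear form, hyperdissipation exponent) and continuation — AFTER existence; nothing before. -/
def NondegenerateCellExists : Prop :=
  ∃ (G : Subgroup (EuclideanSpace ℝ (Fin 3) ≃ₗᵢ[ℝ] EuclideanSpace ℝ (Fin 3))) (c K M : ℝ)
    (v : ℝ → EuclideanSpace ℝ (Fin 3) → EuclideanSpace ℝ (Fin 3)),
    IsPolyhedral G ∧ 1 < c ∧ IsApproxCell G c 0 M v ∧ ¬ (v (-1) =ᵐ[volume] 0) ∧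
      LinearisedClosingInvertible G c K v

/-- `S⁺ → crux` (forget nondegeneracy; landed reduction). -/
theorem crux_of_nondegenerateCell : NondegenerateCellExists → Crux := by
  rintro ⟨G, c, K, M, v, hG, hc, hcell, hnt, -⟩
  obtain ⟨hcell', hL4⟩ := cell_of_approxCell_zero hcell
  exact Theorems.PolyhedralDssProfileExists.PolyhedralCell.stub_profileOfPolyhedralCell
    ⟨G, hG.1, hG.2.1, hG.2.2, c, hc, v, hcell', hL4, hnt⟩

/-! ## §4 Negation: the target is the route's own kill switch -/

/-- The negation of the crux follows from the kill switch `PolyhedralTypeILiouville` (stmt-1405,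
OPEN; landed glue stmt-1408). The census records why no coercive functional is in sight. -/
theorem not_crux_of_killSwitch : Theses.QuantisedSymmetry.PolyhedralTypeILiouville → ¬ Crux :=
  fun hL hX => crux_imp_w3 hX hL

end Summit.NavierStokesRegularity.NavierStokesRegularity.Cruxes.PolyhedralDssProfileExists.StrategistS21

end
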